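import Summits.CriticalPhenomena.CardyFormulaZ2.Theorems.CardyComplexConeSLESixFamiliesGiveCardyLowerRunPart1
import Literature.Probability.Percolation.SitePaths
import Literature.Probability.LatticeModels.MedialInterfaceProofs
import Literature.Probability.RandomPlanarGeometry.PlanarDomainsTopology
import Literature.Probability.RandomPlanarGeometry.MarkedDomainCorners

/-!
# Stub `stub_lowerRun` of line `collar-touch-sandwich` (crux `SLESixFamiliesGiveCardy`,
stmt-CriticalPhenomena-9654) — Part 2: gates, inside paths and the open chain

Helper file for `theorem stub_lowerRun : LowerRun` (the lower run inclusion).  Contents: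

* the GATE LEMMA `mem_discreteArc_of_contact`: a site of `Ω_δ` with a lattice neighbour whose
  closed mesh edge is not an inside step and touches a collar `C` (disjoint from `Ω`, at distance
  `≥ r ≥ 2δ` from the three arcs other than `R.arc k`) is a site of `discreteArc Ω δ (R.arc k)`
  (first frontier point on the segment towards the contact point, `∂Ω = ⋃ arcs`);
* paths of inside steps (`PathIn`) are walks of the mesh vertex graph
  (`reachable_meshVertexGraph_of_pathIn`) and, from a site of `Ω_δ` and with `ω`-open steps,
  open paths of the discrete domain (`reachable_openGraph_inf_of_pathIn`);
* the OPEN CHAIN of the exploration (`lowerRun_chain_pathIn`, registered helper): for admissible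
  data the left vertices of the darts of the medial exploration path form a path of
  `bcBondConfig`-open edges (`IsMedialExploration.left_chain`) inside any set containing the
  `δ`-neighbourhood of the vertices of the path, between sites within `δ` of the midpoints of the
  two `A`–`B` edges.

References: S. Smirnov, C. R. Acad. Sci. Paris 333 (2001), §2; G. Grimmett, *Percolation*
(1999), §11.2.
-/

noncomputable section

open Set Filter Topology Metric MeasureTheory
open scoped NNReal
open Literature.Probability Literature.Probability.RandomPlanarGeometry
  Literature.Probability.LatticeModels Literature.Probability.Percolation

namespace Summit.CriticalPhenomena.CardyFormulaZ2.Cruxes.SLESixFamiliesGiveCardy.CollarTouchSandwich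

/-! ### Gates: contact steps give discrete-arc sites -/

/-- Marked point `k + 2` of a conformal rectangle is off the arc `k`. -/
theorem pt_add_two_not_mem_arc (R : ConformalRectangle) (k : Fin 4) : R.pt (k + 2) ∉ R.arc k := by
  rw [R.pt_mem_arc_iff]
  fin_cases k <;> decide

/-- **Gate lemma.**  Let `C` be a set disjoint from `Ω` at distance `≥ r ≥ 2δ` from the three
arcs of the conformal rectangle `R = (Ω; …)` other than `R.arc k`.  If a site `x ∈ Ω_δ` has a
lattice neighbour `y` whose closed mesh edge `[δx, δy]` contains a point of `C` and is not an
inside step (`δy ∉ Ω` or the edge leaves `closure Ω`), then `x` is a site of the discrete arc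
`discreteArc Ω δ (R.arc k)`: the segment from `δx` to the contact point meets `∂Ω = ⋃ arcs`
within `δ`, necessarily on `R.arc k`, while the rest of `∂Ω` is `≥ r - δ ≥ δ` away. -/
theorem mem_discreteArc_of_contact (R : ConformalRectangle) {C : Set ℂ} {k : Fin 4} {r δ : ℝ}
    (hδ : 0 < δ) (hδr : 2 * δ ≤ r) (hC : Disjoint C R.carrier)
    (hfar : ∀ z ∈ C, ∀ i : Fin 4, i ≠ k → r ≤ infDist z (R.arc i)) {x y : Site 2}
    (hx : x ∈ meshDomain R.carrier δ) (hxy : (zdGraph 2).Adj x y)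
    (hout : meshPoint δ y ∉ R.carrier ∨
      ¬ segment ℝ (meshPoint δ x) (meshPoint δ y) ⊆ closure R.carrier)
    {z : ℂ} (hz : z ∈ segment ℝ (meshPoint δ x) (meshPoint δ y)) (hzC : z ∈ C) :
    x ∈ discreteArc R.carrier δ (R.arc k) := by
  have hxΩ : meshPoint δ x ∈ R.carrier := meshDomain_subset_meshVertices _ _ hx
  have hzΩ : z ∉ R.carrier := Set.disjoint_left.1 hC hzC
  have hxz : dist (meshPoint δ x) z ≤ δ := by
    have := dist_le_dist_of_mem_segment (left_mem_segment ℝ _ _) hz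
    rwa [dist_meshPoint_of_adj hxy, abs_of_pos hδ] at this
  -- the frontier point between `δx` and `z` lies on `R.arc k`
  obtain ⟨w, hw, hwf⟩ := exists_mem_segment_frontier R.isOpen hxΩ
    (fun h => hzΩ (h (right_mem_segment ℝ _ _)))
  have hxw : dist (meshPoint δ x) w ≤ δ :=
    (dist_le_dist_of_mem_segment (left_mem_segment ℝ _ _) hw).trans hxz
  have hwz : dist w z ≤ δ := (dist_le_dist_of_mem_segment hw (right_mem_segment ℝ _ _)).trans hxz
  have harc : ∀ p ∈ frontier R.carrier, dist p z < r → p ∈ R.arc k := by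
    intro p hp hpz
    rw [← R.iUnion_arc_holds] at hp
    obtain ⟨i, hi⟩ := mem_iUnion.1 hp
    by_cases hik : i = k
    · exact hik ▸ hi
    · exact absurd ((hfar z hzC i hik).trans (infDist_le_dist_of_mem hi))
        (by rw [dist_comm]; exact not_le.2 hpz)
  have hwk : w ∈ R.arc k := harc w hwf (by linarith)
  refine ⟨?_, ?_⟩
  · -- a vertex-boundary site
    refine mem_meshBoundary_iff'.2 ⟨hx, y, hxy, ?_⟩
    rcases hout with hy | hseg
    · exact Or.inl fun hy' => hy (meshDomain_subset_meshVertices _ _ hy')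
    · exact Or.inr fun hadj => hseg (meshGraph_adj_iff.1 hadj).2
  · -- closer to `R.arc k` than to the rest of the frontier
    have hne : (frontier R.carrier \ R.arc k).Nonempty :=
      ⟨R.pt (k + 2), R.pt_mem_frontier _, pt_add_two_not_mem_arc R k⟩
    refine ((infDist_le_dist_of_mem hwk).trans hxw).trans ((le_infDist hne).2 fun p hp => ?_)
    by_contra hlt
    have hpz : dist p z < r := by
      have := dist_triangle p (meshPoint δ x) z
      rw [dist_comm p (meshPoint δ x)] at this
      linarith [not_le.1 hlt]
    exact hp.2 (harc p hp.1 hpz)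

/-! ### Paths of inside steps -/

/-- A path whose steps are mesh-graph steps of `Ω` between sites with mesh point in `Ω` is a walk
of the mesh vertex graph of `Ω`. -/
theorem reachable_meshVertexGraph_of_pathIn {Ω : Set ℂ} {δ : ℝ} {H : SimpleGraph (Site 2)}
    {S : Set (Site 2)}
    (hH : ∀ p q, H.Adj p q → (meshGraph Ω δ).Adj p q ∧ meshPoint δ p ∈ Ω ∧ meshPoint δ q ∈ Ω)
    {a b : Site 2} (h : PathIn H S a b) (ha : meshPoint δ a ∈ Ω) :
    ∃ hb : meshPoint δ b ∈ Ω,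
      (meshVertexGraph Ω δ).Reachable (⟨a, ha⟩ : meshVertices Ω δ) ⟨b, hb⟩ := by
  obtain ⟨-, h⟩ := h
  induction h with
  | refl => exact ⟨ha, SimpleGraph.Reachable.refl _⟩
  | @tail p q _ hpq ih =>
    obtain ⟨hp, hreach⟩ := ih
    obtain ⟨hadj, -, hq⟩ := hH p q hpq.1
    exact ⟨hq, hreach.trans (SimpleGraph.Adj.reachable
      (show (meshVertexGraph Ω δ).Adj ⟨p, hp⟩ ⟨q, hq⟩ from hadj))⟩

/-- A path inside `S` whose steps (between sites of `S`) are `ω`-open mesh-graph steps of `Ω`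
towards sites with mesh point in `Ω`, starting at a site of `Ω_δ`, is an open path of the
discrete domain `Ω_δ` (the discrete domain is a union of mesh components). -/
theorem reachable_openGraph_inf_of_pathIn {Ω : Set ℂ} {δ : ℝ} {ω : BondConfig (Site 2)}
    {H : SimpleGraph (Site 2)} {S : Set (Site 2)}
    (hH : ∀ p ∈ S, ∀ q ∈ S, H.Adj p q →
      (meshGraph Ω δ).Adj p q ∧ meshPoint δ q ∈ Ω ∧ s(p, q) ∈ ω)
    {a b : Site 2} (h : PathIn H S a b) (ha : a ∈ meshDomain Ω δ) :
    (openGraph ω ⊓ discreteDomainGraph Ω δ).Reachable a b ∧ b ∈ meshDomain Ω δ := by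
  obtain ⟨haS, h⟩ := h
  suffices H' : (openGraph ω ⊓ discreteDomainGraph Ω δ).Reachable a b ∧ b ∈ meshDomain Ω δ ∧
      b ∈ S from ⟨H'.1, H'.2.1⟩
  induction h with
  | refl => exact ⟨SimpleGraph.Reachable.refl _, ha, haS⟩
  | @tail p q _ hpq ih =>
    obtain ⟨hreach, hp, hpS⟩ := ih
    obtain ⟨hadj, hqΩ, hω⟩ := hH p hpS q hpq.2 hpq.1
    have hq : q ∈ meshDomain Ω δ := mem_meshDomain_of_meshGraph_adj hp hqΩ hadj
    refine ⟨hreach.trans (SimpleGraph.Adj.reachable ?_), hq, hpq.2⟩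
    exact ⟨(openGraph_adj ω p q).2 ⟨hω, hadj.ne⟩, discreteDomainGraph_adj_iff.2 ⟨hadj, hp, hq⟩⟩

/-! ### The open chain of left vertices of the exploration -/

/-- Two distinct members `a ≠ b` of a pair `{x, y}` exhaust it. -/
theorem eq_or_eq_of_mem_pair {α : Type*} {x y a b : α} (ha : a = x ∨ a = y) (hb : b = x ∨ b = y)
    (hab : a ≠ b) {e : α} (he : e = x ∨ e = y) : e = a ∨ e = b := by
  rcases ha with rfl | rfl <;> rcases hb with rfl | rfl
  · exact absurd rfl hab
  · exact he
  · exact he.symm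
  · exact absurd rfl hab

/-- **The open chain of the exploration.**  For admissible data `E` and any configuration `ω`,
the left vertices of the darts of the medial exploration path form a path of the graph of
`bcBondConfig`-open edges (`left_chain`: consecutive left vertices are equal or joined by an
open edge of the completed configuration) inside any set `S` containing every site within `δ`
of a vertex of the path, from a site `u` within `δ` of the midpoint of one `A`–`B` edge `e₁` to
a site `v` within `δ` of the midpoint of the other `A`–`B` edge `e₂` (`{e₁, e₂} ⊇ zdABEdges`
by `ncard_zdABEdges_eq_two`); all these sites are corners of inner faces, so their mesh points
lie in the domain (registered helper of `stub_lowerRun`).  (Smirnov 2001, §2: open edges on the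
left of the exploration path.) -/
theorem lowerRun_chain_pathIn :
    ∀ (E : DiscreteDobrushin), E.IsZdAdmissible → ∀ (ω : BondConfig (Site 2)) (S : Set (Site 2)), (∀ x : Site 2, ∀ e ∈ medialExploration E ω, dist (medialPoint E.δ e) (meshPoint E.δ x) ≤ E.δ → x ∈ S) → ∃ (u v : Site 2) (e₁ e₂ : MedialVertex), E.zdABEdges ⊆ {e₁, e₂} ∧ dist (medialPoint E.δ e₁) (meshPoint E.δ u) ≤ E.δ ∧ dist (medialPoint E.δ e₂) (meshPoint E.δ v) ≤ E.δ ∧ meshPoint E.δ u ∈ E.Ω ∧ meshPoint E.δ v ∈ E.Ω ∧ PathIn (openGraph (E.bcBondConfig ω)) S u v := by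
  intro E hE ω S hS
  classical
  have hγ := isMedialExploration_medialExploration_holds E hE ω
  obtain ⟨a, l, hal⟩ := List.exists_cons_of_ne_nil hγ.ne_nil
  rw [hal] at hγ hS
  have hl : l ≠ [] := by
    intro h
    subst h
    exact hγ.head_ne_getLast rfl
  set Z := (a :: l).zip l with hZ
  have hZlen : Z.length = l.length := by simp [hZ]
  have hlpos : 0 < l.length := List.length_pos_iff.2 hl
  have hcorner : ∀ i : ℕ, ∀ hi : i < Z.length, ∃ v f, IsCorner v f ∧ E.IsInnerFace f ∧
      cornerSource v f = (Z[i]).1 ∧ cornerTarget v f = (Z[i]).2 := fun i hi ↦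
    hγ.exists_corner_getElem i hi
  choose! cv cf hcv hcf hcs hct using hcorner
  have hδ : 0 ≤ E.δ := hE.delta_pos.le
  -- chain sites lie in `S` and have mesh points in the domain
  have hmemS : ∀ i, ∀ hi : i < Z.length, cv i ∈ S := by
    intro i hi
    have hi' : i < (a :: l).length := by rw [List.length_cons]; omega
    refine hS (cv i) (Z[i]).1 ?_ ?_
    · have : (Z[i]).1 = (a :: l)[i] := by simp [hZ, List.getElem_zip]
      rw [this]
      exact List.getElem_mem hi'
    · rw [← hcs i hi]
      exact dist_medialPoint_cornerSource_le hδ (hcv i hi)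
  have hmemΩ : ∀ i, i < Z.length → meshPoint E.δ (cv i) ∈ E.Ω := fun i hi =>
    meshPoint_mem_of_isCorner_of_isInnerFace (hcv i hi) (hcf i hi)
  -- the path from `cv 0` to `cv i`
  have hpath : ∀ i, i < Z.length → PathIn (openGraph (E.bcBondConfig ω)) S (cv 0) (cv i) := by
    intro i
    induction i with
    | zero => exact fun h0 => PathIn.refl (hmemS 0 h0)
    | succ i ih =>
      intro hi
      refine (ih (by omega)).trans (PathIn.of_eq_or_adj (hmemS i (by omega)) (hmemS _ hi) ?_)
      rcases hγ.left_chain (i := i) hi (hcv i (by omega)) (hcs i _) (hct i _) (hcv _ hi)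
          (hcs _ hi) (hct _ hi) with h | h
      · exact Or.inl h
      · refine Or.inr ((openGraph_adj _ _ _).2 ⟨h, fun heq => ?_⟩)
        rw [heq] at h
        exact SimpleGraph.irrefl _ ((SimpleGraph.mem_edgeSet _).1 (E.bcBondConfig_subset ω h))
  -- the two ends
  have hN : l.length - 1 < Z.length := by rw [hZlen]; omega
  have h0 : 0 < Z.length := by rw [hZlen]; exact hlpos
  have hZ0 : (Z[0]).1 = a := by simp [hZ, List.getElem_zip]
  have hZN : (a :: l).getLast (List.cons_ne_nil a l) = (Z[l.length - 1]).2 :=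
    getLast_eq_getElem_zip_snd a l hlpos
  -- the two `A`–`B` edges
  obtain ⟨x, y, hxy, hAB⟩ := Set.ncard_eq_two.1 hE.ncard_zdABEdges_eq_two
  have hhead : (a :: l).head (List.cons_ne_nil a l) ∈ E.zdABEdges := hγ.head_mem
  have hlast : (a :: l).getLast (List.cons_ne_nil a l) ∈ E.zdABEdges := hγ.getLast_mem
  have hne : (a :: l).head (List.cons_ne_nil a l) ≠ (a :: l).getLast (List.cons_ne_nil a l) :=
    hγ.head_ne_getLast
  rw [List.head_cons] at hhead hne
  rw [hAB] at hhead hlast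
  simp only [mem_insert_iff, mem_singleton_iff] at hhead hlast
  refine ⟨cv 0, cv (l.length - 1), a, (a :: l).getLast (List.cons_ne_nil a l), ?_, ?_, ?_,
    hmemΩ 0 h0, hmemΩ _ hN, hpath _ hN⟩
  · intro e he
    rw [hAB] at he
    simp only [mem_insert_iff, mem_singleton_iff] at he ⊢
    exact eq_or_eq_of_mem_pair hhead hlast hne he
  · rw [← hZ0, ← hcs 0 h0]
    exact dist_medialPoint_cornerSource_le hδ (hcv 0 h0)
  · rw [hZN, ← hct _ hN]
    exact dist_medialPoint_cornerTarget_le hδ (hcv _ hN)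

end Summit.CriticalPhenomena.CardyFormulaZ2.Cruxes.SLESixFamiliesGiveCardy.CollarTouchSandwich

end
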